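import Summits.QuantumFields.BalabanUV.Beta.EriceRemainderEnclosureHistoryAutonomyComparisonWitness

/-!
# EriceRemainderEnclosureHistoryAutonomyComparisonIsotoneExcessSharp — (E56a) COMPARISON IN THE FUNCTIONAL WITH ISOTONE EXCESS FAILS BEYOND A
# THRESHOLD: an ISOTONE hinge memory `B(u) = b + M̃·max(1 − 1∕u_L², 0)` of age `L` (floor `b`, zeroth moment `2M̃`) and its translate `B′ = B + ε` by a
# CONSTANT (hence isotone) excess have, from one pin, EXPLICIT box solutions `h` of `B` and `h′` of `B′` with **`h 1 < h′ 1`** — the LARGER functional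
# produces the LARGER coupling at scale 1 — as soon as `0 < ε < x = M̃·η`, `η = (L+1)·ε − x ∈ ]0, b]`, `(L+1)·b + x + η < 1` (§§3–4, all parameters free)

Cell `pub-balaban`, β-function sub-cell, BINDER row D4 «RemainderConst leaves for Bałaban's split» (`HOME/BINDER-OWNERS.md`; owner lineage `b2b-balaban-beta-an4`;
this file by co-owner #2 lineage `b2b-balaban-beta-d4-p2`, generation 50), β-FLOW TEAM duty (1), FREEZE (0) honoured (def-free: the functionals and the level
sequences are displayed lambda terms, as in (E49b) `…ComparisonWitness`, whose `memFlow_of_levels` and node U2's `T4BetaFlowWellPosed.one_div_sq_one_div_sqrt` ∕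
`one_div_sqrt_anti` are used BY NAME; nothing restated).  Sequel of (E49k) `…ComparisonIsotoneExcess` (isotone memory, zeroth moment `M`, floor `b`,
**`M·γ ≤ 3√3·b`**, isotone excess ⟹ `h′ ≤ h` at every scale from every pin) and of the successor question (E50a′) of `HOME/b2b-balaban-beta-d4-p2/g46/E50a-DOSSIER.md`
(«beyond the threshold — OPEN, numerics say TRUE»).  The END module (E56b) `…ComparisonIsotoneExcessSharpEnd` turns this construction into: (E50a′) is FALSE,
and (E49k)'s class constant `3√3` is SHARP.

HONEST FRAMING (page 1, verbatim and binding).  *"Discharging BetaPertH makes Bałaban's UV stability UNCONDITIONAL — a real constructive-QFT result; it is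
NOT the continuum limit and NOT the Clay problem."*  THIS FILE DISCHARGES NOTHING OF THE KIND.  Elementary real analysis (explicit level sequences, a hinge
`max(1 − 1∕y², 0)` that is `2`-Lipschitz) about ABSTRACT functionals on a box ]0,γ]^ℕ with DISPLAYED signs (isotone memory, constant excess) — hypotheses of
a census, not facts; which signs, moments or hinges Bałaban's (1.22) limit functional and its perturbations have is NOT PRINTED ([I] p. 298 says only that
`β_{k+1}` depends on the preceding couplings; GAPS G-t4-U2-1∕-2) and NOT asserted.  Row D4 class UNCHANGED (critical-path width 0; instance 0∕1; D4 DISCHARGE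
NO DATE).  HONEST DEPENDENCY: continuum YM on T⁴ ⇐ BetaPertH ∧ nine spine estimates (0/9 proved); BetaPertH ⇐ (D1) ∧ (D4) ∧ CAP+tail; G-an2-4 gates asym,
D1 and NE2/3/4.

THE POINT (census sense (α); the COMPARISON column of the autonomy row).  (E49) settled «comparison in the functional costs ONE sign»: antitone memory
tolerates any non-negative excess ((E49a)∕(E49c)); isotone memory with an excess ANTITONE in the newest coupling fails ((E49b)); isotone memory with
ISOTONE excess compares on the closed threshold `M·γ ≤ 3√3·b` ((E49k)), by zeroth-moment bookkeeping whose worst case is «all memory weight at the age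
`k` maximising `k·c_k³`, all shifted excesses equal».  (E50a′) asked whether the threshold is an artefact (probes with LINEAR memories `b + M·u_K`, `M ≤ 80`,
and constant excesses found no violation: large linear memory accelerates asymptotic freedom and kills its own leverage).  THIS FILE realises the worst
case instead: a memory that is SILENT except in a thin window — ONE hinge term of age `L`, read at scale `L+1` of the unperturbed trajectory just above
its activation coupling `1` (level `1 − η`), contributing the level `x = M̃·η` at scale `1` and nothing later (§3 `levels_rec`).  Translating `B` by a
constant `ε` adds `(L+1)·ε` to the level of scale `L+1` of the perturbed trajectory; with `η = (L+1)·ε − x` that level is EXACTLY the activation level `1`,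
the hinge is OFF along the whole perturbed trajectory (§3 `levels'_rec`), and the perturbed level at scale `1` is `a 1 − x + ε < a 1` when `ε < x`
(§3 `level'_one_lt`): **`h′ 1 > h 1`** (§4 `h_one_lt_h'_one`).  Both trajectories are written down by their levels (`a₀`, then one step `b`, resp. `b + ε`,
per scale) and checked to solve the IMPLICIT flows (§4 `memFlow_h`, `memFlow_h'`, via (E49b)'s `memFlow_of_levels`); uniqueness ((E43b), isotone + zeroth
moment, any size) is not even needed.  The functional data: §2 — `B` has floor `b`, is ISOTONE, has zeroth moment `2M̃` on every box (§1: the hinge is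
`2`-Lipschitz on ]0,∞[, OFF below the coupling `1`); `B′ = B + ε` likewise, `B ≤ B′`, excess constant.  The zeroth-moment size of the instance is
`M·γ = 2M̃∕√a₀`, `a₀ = 1 − η − (L+1)·b − x` the pin level; (E56b) optimises it down to (E49k)'s `3√3·b`.

WHAT IS PROVED ([folklore]; 0 `def`, 0 sorry).  §1 `abs_inv_sq_sub_inv_sq_le_two`, `min_inv_sq_one`, `hinge_eq`, `hinge_nonneg`, `hinge_mono`,
**`abs_hinge_sub_le`**, `hinge_level_eq_zero`.  §2 `floor_le_B`, **`B_isotone`**, **`B_zerothMoment`**, `B_le_B'`, `excess_isotone`, `floor_le_B'`, `B'_isotone`,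
`B'_zerothMoment`.  §3 `seqBox_of_levels_ge`, `one_div_sqrt_strictAnti`, `levels_ge`, **`levels_rec`**, `levels'_ge`, **`levels'_rec`**, **`level'_one_lt`**.
§4 **`memFlow_h`**, **`memFlow_h'`**, **`h_one_lt_h'_one`**.
-/
noncomputable section
open Finset Set

namespace Summit.QuantumFields.BalabanUV.Beta.EriceRemainderEnclosureHistoryAutonomyComparisonIsotoneExcessSharp

open Literature.MathematicalPhysics.QuantumFieldTheory.Balaban1983to89
open Literature.MathematicalPhysics.QuantumFieldTheory.Balaban1983to89.T4BetaStationary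
open Literature.MathematicalPhysics.QuantumFieldTheory.Balaban1983to89.T4BetaFlowWellPosed
open Summit.QuantumFields.BalabanUV.Beta.EriceRemainderEnclosureHistoryAutonomyComparisonWitness (memFlow_of_levels)

variable {γ b Mt ε x η a₀ : ℝ} {L : ℕ}

/-! ## §1 The hinge `y ↦ max(1 − 1∕y², 0)`: off below the coupling `1`, slope at most `2` above it -/

/-- `z ↦ 1∕z²` is `2`-Lipschitz on `[1, ∞[`. [folklore] -/
theorem abs_inv_sq_sub_inv_sq_le_two {z z' : ℝ} (hz : 1 ≤ z) (hz' : 1 ≤ z') :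
    |1 / z ^ 2 - 1 / z' ^ 2| ≤ 2 * |z - z'| := by
  have hz0 : 0 < z := by linarith
  have hz'0 : 0 < z' := by linarith
  have e : 1 / z ^ 2 - 1 / z' ^ 2 = (z' - z) * ((z' + z) / (z ^ 2 * z' ^ 2)) := by
    field_simp
    ring
  rw [e, abs_mul, abs_of_nonneg (by positivity : 0 ≤ (z' + z) / (z ^ 2 * z' ^ 2)), abs_sub_comm, mul_comm]
  refine mul_le_mul_of_nonneg_right ?_ (abs_nonneg _)
  rw [div_le_iff₀ (by positivity)]
  have h2 : z * 1 ≤ z ^ 2 * z' ^ 2 := mul_le_mul (by nlinarith) (by nlinarith) zero_le_one (sq_nonneg z)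
  have h2' : 1 * z' ≤ z ^ 2 * z' ^ 2 := mul_le_mul (by nlinarith) (by nlinarith) hz'0.le (sq_nonneg z)
  linarith

/-- The clipped inverse square: `min(1∕y², 1) = 1∕max(y, 1)²` for `y > 0`. [folklore] -/
theorem min_inv_sq_one {y : ℝ} (hy : 0 < y) : min (1 / y ^ 2) 1 = 1 / (max y 1) ^ 2 := by
  rcases le_or_gt y 1 with hle | hlt
  · rw [max_eq_right hle, min_eq_right]
    · norm_num
    · rw [le_div_iff₀ (by positivity)]; nlinarith
  · rw [max_eq_left hlt.le, min_eq_left]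
    rw [div_le_iff₀ (by positivity)]; nlinarith

/-- THE HINGE `y ↦ max(1 − 1∕y², 0)` equals `1 − min(1∕y², 1)`. [folklore] -/
theorem hinge_eq (y : ℝ) : max (1 - 1 / y ^ 2) 0 = 1 - min (1 / y ^ 2) 1 := by
  rcases le_or_gt (1 / y ^ 2) 1 with h | h
  · rw [min_eq_left h, max_eq_left (by linarith)]
  · rw [min_eq_right h.le, max_eq_right (by linarith)]; ring

/-- The hinge is NON-NEGATIVE … [folklore] -/
theorem hinge_nonneg (y : ℝ) : 0 ≤ max (1 - 1 / y ^ 2) 0 := le_max_right _ _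

/-- … NON-DECREASING in the coupling (ISOTONE memory) … [folklore] -/
theorem hinge_mono {y y' : ℝ} (hy : 0 < y) (hyy' : y ≤ y') : max (1 - 1 / y ^ 2) 0 ≤ max (1 - 1 / y' ^ 2) 0 := by
  refine max_le_max ?_ le_rfl
  have : 1 / y' ^ 2 ≤ 1 / y ^ 2 := one_div_le_one_div_of_le (by positivity) (pow_le_pow_left₀ hy.le hyy' 2)
  linarith

/-- … and `2`-LIPSCHITZ on ]0, ∞[ (OFF below the coupling `1`, slope `2∕y³ ≤ 2` above it). [folklore] -/
theorem abs_hinge_sub_le {y y' : ℝ} (hy : 0 < y) (hy' : 0 < y') :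
    |max (1 - 1 / y ^ 2) 0 - max (1 - 1 / y' ^ 2) 0| ≤ 2 * |y - y'| := by
  rw [hinge_eq, hinge_eq, min_inv_sq_one hy, min_inv_sq_one hy',
    show (1 : ℝ) - 1 / max y 1 ^ 2 - (1 - 1 / max y' 1 ^ 2) = -(1 / max y 1 ^ 2 - 1 / max y' 1 ^ 2) by ring, abs_neg]
  calc |1 / max y 1 ^ 2 - 1 / max y' 1 ^ 2| ≤ 2 * |max y 1 - max y' 1| :=
        abs_inv_sq_sub_inv_sq_le_two (le_max_right _ _) (le_max_right _ _)
    _ ≤ 2 * |y - y'| := mul_le_mul_of_nonneg_left (abs_max_sub_max_le_abs _ _ _) (by norm_num)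

/-- In LEVEL variables the hinge reads `max(1 − S, 0)` at the coupling `1∕√S` (`S > 0`): it is OFF (`= 0`) at levels `S ≥ 1` … [folklore] -/
theorem hinge_level_eq_zero {S : ℝ} (hS : 1 ≤ S) : max (1 - S) 0 = 0 := max_eq_right (by linarith)

/-! ## §2 The functionals: the isotone hinge memory `B(u) = b + M̃·max(1 − 1∕u_L², 0)` of age `L` and its translate `B′ = B + ε` -/

/-- **THE ISOTONE HINGE MEMORY `B(u) = b + M̃·max(1 − 1∕u_L², 0)`** (floor `b`, ONE memory term of age `L`, strength `M̃ ≥ 0`, silent while the coupling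
of age `L` is `≤ 1`) has floor `b` … [folklore] -/
theorem floor_le_B (hMt : 0 ≤ Mt) (u : ℕ → ℝ) : b ≤ (fun w : ℕ → ℝ => b + Mt * max (1 - 1 / w L ^ 2) 0) u := by
  simp only
  nlinarith [hinge_nonneg (u L)]

/-- … is ISOTONE in the history (pointwise order on the box ]0,γ]) … [folklore] -/
theorem B_isotone (hMt : 0 ≤ Mt) : ∀ u v : ℕ → ℝ, SeqBox γ u → SeqBox γ v → (∀ j, u j ≤ v j) →
    (fun w : ℕ → ℝ => b + Mt * max (1 - 1 / w L ^ 2) 0) u ≤ (fun w : ℕ → ℝ => b + Mt * max (1 - 1 / w L ^ 2) 0) v := by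
  intro u v hu _ huv
  simp only
  nlinarith [hinge_mono (hu L).1 (huv L)]

/-- … and has ZEROTH MOMENT `2·M̃` on every box ]0,γ]. [folklore] -/
theorem B_zerothMoment (hMt : 0 ≤ Mt) : ∀ u u' : ℕ → ℝ, SeqBox γ u → SeqBox γ u' → ∀ D : ℝ, (∀ j, |u j - u' j| ≤ D) →
    |(fun w : ℕ → ℝ => b + Mt * max (1 - 1 / w L ^ 2) 0) u - (fun w : ℕ → ℝ => b + Mt * max (1 - 1 / w L ^ 2) 0) u'|
      ≤ 2 * Mt * D := by
  intro u u' hu hu' D hD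
  simp only
  rw [show b + Mt * max (1 - 1 / u L ^ 2) 0 - (b + Mt * max (1 - 1 / u' L ^ 2) 0)
      = Mt * (max (1 - 1 / u L ^ 2) 0 - max (1 - 1 / u' L ^ 2) 0) by ring, abs_mul, abs_of_nonneg hMt]
  calc Mt * |max (1 - 1 / u L ^ 2) 0 - max (1 - 1 / u' L ^ 2) 0| ≤ Mt * (2 * |u L - u' L|) :=
        mul_le_mul_of_nonneg_left (abs_hinge_sub_le (hu L).1 (hu' L).1) hMt
    _ ≤ Mt * (2 * D) := mul_le_mul_of_nonneg_left (mul_le_mul_of_nonneg_left (hD L) (by norm_num)) hMt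
    _ = 2 * Mt * D := by ring

/-- **THE TRANSLATE `B′ = B + ε`** (`ε ≥ 0`: a CONSTANT, hence ISOTONE, excess) dominates `B` … [folklore] -/
theorem B_le_B' (hε : 0 ≤ ε) (u : ℕ → ℝ) :
    (fun w : ℕ → ℝ => b + Mt * max (1 - 1 / w L ^ 2) 0) u ≤ (fun w : ℕ → ℝ => b + Mt * max (1 - 1 / w L ^ 2) 0 + ε) u := by
  simp only; linarith

/-- … with an excess that is (trivially) ISOTONE in the history … [folklore] -/
theorem excess_isotone (u v : ℕ → ℝ) :
    (fun w : ℕ → ℝ => b + Mt * max (1 - 1 / w L ^ 2) 0 + ε) u - (fun w : ℕ → ℝ => b + Mt * max (1 - 1 / w L ^ 2) 0) u ≤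
      (fun w : ℕ → ℝ => b + Mt * max (1 - 1 / w L ^ 2) 0 + ε) v - (fun w : ℕ → ℝ => b + Mt * max (1 - 1 / w L ^ 2) 0) v := by
  simp only; linarith

/-- … has floor `b` (indeed `b + ε`) … [folklore] -/
theorem floor_le_B' (hMt : 0 ≤ Mt) (hε : 0 ≤ ε) (u : ℕ → ℝ) : b ≤ (fun w : ℕ → ℝ => b + Mt * max (1 - 1 / w L ^ 2) 0 + ε) u :=
  (floor_le_B hMt u).trans (B_le_B' hε u)

/-- … is ISOTONE … [folklore] -/
theorem B'_isotone (hMt : 0 ≤ Mt) : ∀ u v : ℕ → ℝ, SeqBox γ u → SeqBox γ v → (∀ j, u j ≤ v j) →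
    (fun w : ℕ → ℝ => b + Mt * max (1 - 1 / w L ^ 2) 0 + ε) u ≤ (fun w : ℕ → ℝ => b + Mt * max (1 - 1 / w L ^ 2) 0 + ε) v := by
  intro u v hu hv huv
  have := B_isotone (b := b) (L := L) hMt u v hu hv huv
  simp only at this ⊢
  linarith

/-- … and has the same zeroth moment `2·M̃`. [folklore] -/
theorem B'_zerothMoment (hMt : 0 ≤ Mt) : ∀ u u' : ℕ → ℝ, SeqBox γ u → SeqBox γ u' → ∀ D : ℝ, (∀ j, |u j - u' j| ≤ D) →
    |(fun w : ℕ → ℝ => b + Mt * max (1 - 1 / w L ^ 2) 0 + ε) u - (fun w : ℕ → ℝ => b + Mt * max (1 - 1 / w L ^ 2) 0 + ε) u'|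
      ≤ 2 * Mt * D := by
  intro u u' hu hu' D hD
  have := B_zerothMoment (b := b) (L := L) hMt u u' hu hu' D hD
  simp only at this ⊢
  rwa [show b + Mt * max (1 - 1 / u L ^ 2) 0 + ε - (b + Mt * max (1 - 1 / u' L ^ 2) 0 + ε)
      = b + Mt * max (1 - 1 / u L ^ 2) 0 - (b + Mt * max (1 - 1 / u' L ^ 2) 0) by ring]


/-! ## §3 Histories by their levels; the two explicit level sequences -/

/-- Levels bounded below by `a₀ > 0` give a history in the box ]0, 1∕√a₀]. [folklore] -/
theorem seqBox_of_levels_ge {a : ℕ → ℝ} (ha₀ : 0 < a₀) (ha : ∀ j, a₀ ≤ a j) :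
    SeqBox (1 / Real.sqrt a₀) (fun j => 1 / Real.sqrt (a j)) := fun j =>
  ⟨one_div_pos.mpr (Real.sqrt_pos.mpr (ha₀.trans_le (ha j))), one_div_sqrt_anti ha₀ (ha j)⟩

/-- `1∕√S < 1∕√S′` as soon as `S′ < S` (`0 < S′`). [folklore] -/
theorem one_div_sqrt_strictAnti {S S' : ℝ} (hS' : 0 < S') (h : S' < S) : 1 / Real.sqrt S < 1 / Real.sqrt S' :=
  one_div_lt_one_div_of_lt (Real.sqrt_pos.mpr hS') (Real.sqrt_lt_sqrt hS'.le h)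

section Levels

variable {a a' : ℕ → ℝ}

/-- THE UNPERTURBED LEVELS `a₀; 1 − η − L·b, 1 − η − (L−1)·b, …` (one floor step `b` per scale from scale `1` on; level `1 − η` at scale `L+1`)
stay above the pin level `a₀ = 1 − η − (L+1)·b − x` … [folklore] -/
theorem levels_ge (hb : 0 < b) (hx : 0 < x) (ha₀ : a₀ = 1 - η - ((L : ℝ) + 1) * b - x) (ha0 : a 0 = a₀)
    (haS : ∀ m : ℕ, a (m + 1) = 1 - η + ((m : ℝ) - L) * b) (j : ℕ) : a₀ ≤ a j := by
  rcases j with _ | m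
  · rw [ha0]
  · rw [haS, ha₀]
    have : (0 : ℝ) ≤ m := Nat.cast_nonneg m
    nlinarith

/-- … and satisfy THE LEVEL RECURSION OF THE HINGE MEMORY: at scale `0` the hinge READS the level `1 − η < 1` of scale `L+1` and contributes `M̃·η = x`;
from scale `1` on the levels it reads are `≥ 1 − η + b ≥ 1` and it is SILENT. [folklore] -/
theorem levels_rec (hη : 0 < η) (hηb : η ≤ b) (hMt : Mt * η = x) (ha₀ : a₀ = 1 - η - ((L : ℝ) + 1) * b - x) (ha0 : a 0 = a₀)
    (haS : ∀ m : ℕ, a (m + 1) = 1 - η + ((m : ℝ) - L) * b) (m : ℕ) :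
    a (m + 1) = a m + (b + Mt * max (1 - a (m + 1 + L)) 0) := by
  rcases m with _ | k
  · rw [show 0 + 1 + L = L + 1 by ring, haS, ha0, haS, ha₀, max_eq_left (by linarith)]
    push_cast
    linear_combination -hMt
  · rw [show k + 1 + 1 + L = (k + 1 + L) + 1 by ring, haS, haS, haS, hinge_level_eq_zero ?_]
    · push_cast; ring
    · have : (0 : ℝ) ≤ k := Nat.cast_nonneg k
      push_cast; nlinarith

/-- THE PERTURBED LEVELS `a₀; 1 − η − x + ε − L·b, …` (one step `b + ε` per scale from scale `1` on; level EXACTLY `1` at scale `L+1` because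
`η = (L+1)·ε − x`) stay above `a₀` … [folklore] -/
theorem levels'_ge (hb : 0 < b) (hε : 0 < ε) (ha₀ : a₀ = 1 - η - ((L : ℝ) + 1) * b - x) (ha'0 : a' 0 = a₀)
    (ha'S : ∀ m : ℕ, a' (m + 1) = 1 - η - x + ε + ((m : ℝ) - L) * b + (m : ℝ) * ε) (j : ℕ) : a₀ ≤ a' j := by
  rcases j with _ | m
  · rw [ha'0]
  · rw [ha'S, ha₀]
    have : (0 : ℝ) ≤ m := Nat.cast_nonneg m
    nlinarith

/-- … and satisfy THE LEVEL RECURSION OF THE TRANSLATE `B′ = B + ε`: at scale `0` the hinge reads the level `1` — SILENT (the accumulated excess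
`(L+1)·ε` net of the lost hinge contribution `x` has pushed the coupling of scale `L+1` down to the activation point); from scale `1` on it reads
levels `≥ 1 + b + ε` — SILENT. [folklore] -/
theorem levels'_rec (hb : 0 < b) (hε : 0 < ε) (hη : η = ((L : ℝ) + 1) * ε - x) (ha₀ : a₀ = 1 - η - ((L : ℝ) + 1) * b - x)
    (ha'0 : a' 0 = a₀) (ha'S : ∀ m : ℕ, a' (m + 1) = 1 - η - x + ε + ((m : ℝ) - L) * b + (m : ℝ) * ε) (m : ℕ) :
    a' (m + 1) = a' m + (b + Mt * max (1 - a' (m + 1 + L)) 0 + ε) := by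
  rcases m with _ | k
  · rw [show 0 + 1 + L = L + 1 by ring, ha'S, ha'0, ha'S, ha₀, hinge_level_eq_zero (by linarith)]
    push_cast
    linarith
  · rw [show k + 1 + 1 + L = (k + 1 + L) + 1 by ring, ha'S, ha'S, ha'S, hinge_level_eq_zero ?_]
    · push_cast; ring
    · have : (0 : ℝ) ≤ k := Nat.cast_nonneg k
      push_cast; nlinarith

/-- THE VIOLATION IN LEVELS: the perturbed level at scale `1` is `a 1 − x + ε < a 1` — the lost hinge contribution `x` beats the excess `ε`. [folklore] -/
theorem level'_one_lt (hεx : ε < x) (haS : ∀ m : ℕ, a (m + 1) = 1 - η + ((m : ℝ) - L) * b)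
    (ha'S : ∀ m : ℕ, a' (m + 1) = 1 - η - x + ε + ((m : ℝ) - L) * b + (m : ℝ) * ε) : a' 1 < a 1 := by
  rw [show (1 : ℕ) = 0 + 1 from rfl, haS, ha'S]
  push_cast
  linarith

/-! ## §4 The explicit box solutions `h = 1∕√a` of `B` and `h′ = 1∕√a′` of `B′` from the pin `p = 1∕√a₀`, and `h 1 < h′ 1` -/

/-- **`h = 1∕√a` IS A BOX SOLUTION OF THE HINGE MEMORY `B` FROM THE PIN `1∕√a₀`**, in the box ]0, 1∕√a₀]. [folklore] -/
theorem memFlow_h (hb : 0 < b) (hη : 0 < η) (hηb : η ≤ b) (hx : 0 < x) (hMt : Mt * η = x)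
    (ha₀ : a₀ = 1 - η - ((L : ℝ) + 1) * b - x) (ha₀0 : 0 < a₀) (ha0 : a 0 = a₀)
    (haS : ∀ m : ℕ, a (m + 1) = 1 - η + ((m : ℝ) - L) * b) :
    SeqBox (1 / Real.sqrt a₀) (fun j => 1 / Real.sqrt (a j)) ∧
      MemFlow (fun w : ℕ → ℝ => b + Mt * max (1 - 1 / w L ^ 2) 0) (1 / Real.sqrt a₀) (fun j => 1 / Real.sqrt (a j)) := by
  have hge := levels_ge hb hx ha₀ ha0 haS
  have hpos : ∀ j, 0 < a j := fun j => ha₀0.trans_le (hge j)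
  refine ⟨seqBox_of_levels_ge ha₀0 hge,
    memFlow_of_levels (by positivity) hpos (by rw [ha0, one_div_sq_one_div_sqrt ha₀0]) fun m => ?_⟩
  simp only [one_div_sq_one_div_sqrt (hpos _)]
  exact levels_rec hη hηb hMt ha₀ ha0 haS m

/-- **`h′ = 1∕√a′` IS A BOX SOLUTION OF THE TRANSLATE `B′ = B + ε` FROM THE SAME PIN**, in the same box. [folklore] -/
theorem memFlow_h' (hb : 0 < b) (hε : 0 < ε) (hη : η = ((L : ℝ) + 1) * ε - x)
    (ha₀ : a₀ = 1 - η - ((L : ℝ) + 1) * b - x) (ha₀0 : 0 < a₀) (ha'0 : a' 0 = a₀)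
    (ha'S : ∀ m : ℕ, a' (m + 1) = 1 - η - x + ε + ((m : ℝ) - L) * b + (m : ℝ) * ε) :
    SeqBox (1 / Real.sqrt a₀) (fun j => 1 / Real.sqrt (a' j)) ∧
      MemFlow (fun w : ℕ → ℝ => b + Mt * max (1 - 1 / w L ^ 2) 0 + ε) (1 / Real.sqrt a₀) (fun j => 1 / Real.sqrt (a' j)) := by
  have hge := levels'_ge hb hε ha₀ ha'0 ha'S
  have hpos : ∀ j, 0 < a' j := fun j => ha₀0.trans_le (hge j)
  refine ⟨seqBox_of_levels_ge ha₀0 hge,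
    memFlow_of_levels (by positivity) hpos (by rw [ha'0, one_div_sq_one_div_sqrt ha₀0]) fun m => ?_⟩
  simp only [one_div_sq_one_div_sqrt (hpos _)]
  exact levels'_rec hb hε hη ha₀ ha'0 ha'S m

/-- **THE VIOLATION: `h 1 < h′ 1`** — from the SAME pin, the box solution of the LARGER functional `B′ = B + ε` lies strictly ABOVE that of `B` at
scale `1`. [folklore] -/
theorem h_one_lt_h'_one (hb : 0 < b) (hε : 0 < ε) (hεx : ε < x) (ha₀ : a₀ = 1 - η - ((L : ℝ) + 1) * b - x) (ha₀0 : 0 < a₀)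
    (haS : ∀ m : ℕ, a (m + 1) = 1 - η + ((m : ℝ) - L) * b) (ha'0 : a' 0 = a₀)
    (ha'S : ∀ m : ℕ, a' (m + 1) = 1 - η - x + ε + ((m : ℝ) - L) * b + (m : ℝ) * ε) :
    (fun j => 1 / Real.sqrt (a j)) 1 < (fun j => 1 / Real.sqrt (a' j)) 1 :=
  one_div_sqrt_strictAnti (ha₀0.trans_le (levels'_ge hb hε ha₀ ha'0 ha'S 1)) (level'_one_lt hεx haS ha'S)

end Levels

end Summit.QuantumFields.BalabanUV.Beta.EriceRemainderEnclosureHistoryAutonomyComparisonIsotoneExcessSharp
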